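import Summits.QuantumFields.BalabanUV.T4Continuum.Spine.NE7c.LiveFactorRestrictedGaussian

/-!
# `T4Continuum.Spine.NE7c.LiveFactorCouplingConvention` — spine estimate NE7c (node U5b), road (δ) THRESHOLD RANDOMISATION:
# the census's ONE CONVENTION ITEM C5′ (record `HOME/ne/NE7c.md` §7.3 row 34) SIZED in kernel form — an expectation read
# off a threshold-RESTRICTED measure moves by at most `2·sup|f|·(mass outside the restriction)` when the restriction is
# changed or removed; with the companion's tail form this is `≦ 4·sup|f|·exp(−target)` UNIFORMLY in the live factor
# (cell `pub-balaban-gaps`, track G2, seat ne8 gen 3; record §10.2)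

HONEST FRAMING.  Finite four-torus programme, rung (B)+1 only — NOT infinite volume, NOT a mass gap, NOT the Clay
problem, NOT summit progress, NOT a proof of NE7c (`T4IndicatorShell.ShellWeightBound`, INSTANCE 0∕1, which waits on
node O).  Nothing of [Bałaban 1983–89] is asserted.  This file is folklore measure theory (Mathlib's Bochner integral on a
probability space); it prices a convention item, it does not decide it.

THE ITEM (census §7.3 row 34, located on the x2 render of [B12] p. 266 and at (2.10)∕(2.13), (5.42) p. 297, p. 280).
Print offers two conventions for the fluctuation restriction `χ_k` inside the effective action `E^{(k+1)} := log` of the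
`χ_k`-RESTRICTED fluctuation integral ((2.9): «χ_k = Π χ({|B′(b)| < ε₁})»; remark: «Another possibility is to take g_k∕γ_kε₁
instead of ε₁ … It has the advantage that the functions E^{(j)}, β_j are analytic functions of the effective coupling
constants, but it has some disadvantages in perturbative calculations also»), and defines `β` from the second-order tensor
of that action ((5.42) «the fundamental equality defining the β-function»).  Road (δ) keeps the run — the integrals
`Z_K(t)` and the coupling sequence — FIXED (computed once, with print's thresholds; census class C9: the normalisation
`N_k` cancels in `log Z_K(t) − log Z_K(0)`), and RE-EXPANDS it with the live thresholds `λ·ε`, `λ ∈ [λ₀, 1]`.  On the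
reading «β_j is the threshold-free perturbative tensor» (class C5) nothing moves.  On the reading «β_j is read off the
χ_k-restricted action» the re-expansion meets, at each live level, the mismatch between an expectation restricted at `λε`
and the same expectation restricted at `ε` — C5′.  WHAT IS PROVED HERE is its SIZE: §1 for a probability measure `P`, a
real observable `|f| ≦ C` and a measurable restriction `S`, `|⟨f⟩_S − ⟨f⟩| ≦ 2C·P(Sᶜ)` where `⟨f⟩_S = P(S)⁻¹∫_S f dP`
(`abs_restrictedMean_sub_mean_le`; no positivity of `P(S)` needed); §2 for two nested restrictions `S ⊆ S′`,
`|⟨f⟩_S − ⟨f⟩_{S′}| ≦ 4C·P(Sᶜ)` (`abs_restrictedMean_sub_restrictedMean_le`); §3 the live threshold: the small-field set at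
the LOWERED threshold `{∀ b, |X_b| < λθ}` sits inside print's `{∀ b, |X_b| < θ}` for `λ ≦ 1` (`smallFieldSet_mono`), its
complement has mass `≦ exp(−target)` by the companion's tail form (`Spine.NE7c.LiveFactorRestrictedGaussian.
restrictedMass_lower_live`, converted to real currency by `measureReal_compl_le_of_one_le_add`), hence the HEADLINE
`restrictedMean_mismatch_live`: `|⟨f⟩_{λθ} − ⟨f⟩_{θ}| ≦ 4C·exp(−target)` for EVERY `λ ∈ [λ₀, 1]`, the clause
`log(2#B) + target ≦ λ₀²θ²∕(2v)` being asked ONCE at `λ₀` — an exponentially small, C1-type quantity («g small» depending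
on `λ₀ = 1 − β′`); and `restrictedMean_sub_mean_live`: against the THRESHOLD-FREE convention, `|⟨f⟩_{λθ} − ⟨f⟩| ≦ 2C·exp(−target)`.  WHAT IS NOT PROVED (design, for the (α)-instance; told to U5a∕NE4 in the record): that this mismatch
is carried as one more 𝐑-class term per live level and absorbed by [B14] p. 260's mechanism («terms … defined by integrals
including large field domains … marginal terms with bounds O(1)(L^jη)⁴g_j^{κ₀}exp(−κd_j(X))»); nothing identifies `f` with
print's second-order tensor; no `def … : Prop` hypothesis is minted; 0 sorry.
-/

namespace Summit.QuantumFields.BalabanUV.T4Continuum.Spine.NE7c.LiveFactorCouplingConvention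

open MeasureTheory Set
open scoped ENNReal
open Summit.QuantumFields.BalabanUV.T4Continuum.Spine.NE7c.LiveFactorRestrictedGaussian

noncomputable section

/-! ## §1. A restricted expectation versus the unrestricted one -/

/-- **RESTRICTED VS UNRESTRICTED EXPECTATION.**  For a probability measure `P`, an integrable real observable with
`|f| ≦ C` everywhere and a measurable restriction `S`: the conditional mean `P(S)⁻¹·∫_S f dP` differs from the mean `∫ f dP`
by at most `2C·P(Sᶜ)`.  (If `P(S) = 0` the restricted mean is `0` by convention and the bound reads `|∫ f| ≦ C ≦ 2C`,
`P(Sᶜ) = 1`.)  Proof: `∫ f = ∫_S f + ∫_{Sᶜ} f`, `|∫_S f| ≦ C·P(S)`, `|∫_{Sᶜ} f| ≦ C·P(Sᶜ)`, and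
`P(S)⁻¹ − 1 = P(Sᶜ)∕P(S)`. [folklore] -/
theorem abs_restrictedMean_sub_mean_le {Ω : Type*} [MeasurableSpace Ω] (P : Measure Ω) [IsProbabilityMeasure P]
    {f : Ω → ℝ} {C : ℝ} (hC : 0 ≤ C) (hf : ∀ ω, |f ω| ≤ C) (hfi : Integrable f P) {S : Set Ω}
    (hS : MeasurableSet S) :
    |(P.real S)⁻¹ * ∫ ω in S, f ω ∂P - ∫ ω, f ω ∂P| ≤ 2 * C * P.real Sᶜ := by
  have hsplit : ∫ ω, f ω ∂P = ∫ ω in S, f ω ∂P + ∫ ω in Sᶜ, f ω ∂P := (integral_add_compl hS hfi).symm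
  have hIS : |∫ ω in S, f ω ∂P| ≤ C * P.real S := by
    have := norm_setIntegral_le_of_norm_le_const (μ := P) (s := S) (f := f) (measure_lt_top P S)
      (fun ω _ => by rw [Real.norm_eq_abs]; exact hf ω)
    simpa [Real.norm_eq_abs] using this
  have hISc : |∫ ω in Sᶜ, f ω ∂P| ≤ C * P.real Sᶜ := by
    have := norm_setIntegral_le_of_norm_le_const (μ := P) (s := Sᶜ) (f := f) (measure_lt_top P Sᶜ)
      (fun ω _ => by rw [Real.norm_eq_abs]; exact hf ω)
    simpa [Real.norm_eq_abs] using this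
  have hcompl : P.real S + P.real Sᶜ = 1 := by
    rw [measureReal_add_measureReal_compl hS, probReal_univ]
  have hS0 : 0 ≤ P.real S := measureReal_nonneg
  have hSc0 : 0 ≤ P.real Sᶜ := measureReal_nonneg
  rcases eq_or_lt_of_le hS0 with hzero | hpos
  · -- degenerate restriction: the restricted mean is `0`, the mass outside is `1`
    have hSc1 : P.real Sᶜ = 1 := by linarith
    rw [← hzero, inv_zero, zero_mul, zero_sub, abs_neg, hSc1, mul_one, hsplit]
    have hIS' : |∫ ω in S, f ω ∂P| ≤ 0 := by simpa [← hzero] using hIS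
    have h0 : ∫ ω in S, f ω ∂P = 0 := abs_nonpos_iff.mp hIS'
    rw [h0, zero_add]
    calc |∫ ω in Sᶜ, f ω ∂P| ≤ C * P.real Sᶜ := hISc
      _ = C := by rw [hSc1, mul_one]
      _ ≤ 2 * C := by linarith
  · -- generic case
    have hkey : (P.real S)⁻¹ * ∫ ω in S, f ω ∂P - ∫ ω, f ω ∂P =
        (P.real Sᶜ / P.real S) * ∫ ω in S, f ω ∂P - ∫ ω in Sᶜ, f ω ∂P := by
      rw [hsplit]
      have h1 : P.real Sᶜ = 1 - P.real S := by linarith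
      rw [h1]
      field_simp
      ring
    rw [hkey]
    have hA : |(P.real Sᶜ / P.real S) * ∫ ω in S, f ω ∂P| ≤ C * P.real Sᶜ := by
      rw [abs_mul, abs_of_nonneg (div_nonneg hSc0 hS0)]
      calc P.real Sᶜ / P.real S * |∫ ω in S, f ω ∂P| ≤ P.real Sᶜ / P.real S * (C * P.real S) :=
            mul_le_mul_of_nonneg_left hIS (div_nonneg hSc0 hS0)
        _ = C * P.real Sᶜ := by field_simp
    calc |(P.real Sᶜ / P.real S) * ∫ ω in S, f ω ∂P - ∫ ω in Sᶜ, f ω ∂P|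
        ≤ |(P.real Sᶜ / P.real S) * ∫ ω in S, f ω ∂P| + |∫ ω in Sᶜ, f ω ∂P| := abs_sub _ _
      _ ≤ C * P.real Sᶜ + C * P.real Sᶜ := add_le_add hA hISc
      _ = 2 * C * P.real Sᶜ := by ring

/-! ## §2. Two nested restrictions -/

/-- **TWO NESTED RESTRICTIONS.**  For `S ⊆ S′` (both measurable), `|f| ≦ C`: the two restricted means differ by at most
`2C·(P(Sᶜ) + P(S′ᶜ)) ≦ 4C·P(Sᶜ)` — the mass outside the SMALLER set controls both. [folklore] -/
theorem abs_restrictedMean_sub_restrictedMean_le {Ω : Type*} [MeasurableSpace Ω] (P : Measure Ω)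
    [IsProbabilityMeasure P] {f : Ω → ℝ} {C : ℝ} (hC : 0 ≤ C) (hf : ∀ ω, |f ω| ≤ C) (hfi : Integrable f P)
    {S S' : Set Ω} (hS : MeasurableSet S) (hS' : MeasurableSet S') (hsub : S ⊆ S') :
    |(P.real S)⁻¹ * ∫ ω in S, f ω ∂P - (P.real S')⁻¹ * ∫ ω in S', f ω ∂P| ≤ 4 * C * P.real Sᶜ := by
  have h1 := abs_restrictedMean_sub_mean_le P hC hf hfi hS
  have h2 := abs_restrictedMean_sub_mean_le P hC hf hfi hS'
  have hmono : P.real S'ᶜ ≤ P.real Sᶜ := measureReal_mono (compl_subset_compl.mpr hsub)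
  calc |(P.real S)⁻¹ * ∫ ω in S, f ω ∂P - (P.real S')⁻¹ * ∫ ω in S', f ω ∂P|
      ≤ |(P.real S)⁻¹ * ∫ ω in S, f ω ∂P - ∫ ω, f ω ∂P| +
          |∫ ω, f ω ∂P - (P.real S')⁻¹ * ∫ ω in S', f ω ∂P| := abs_sub_le _ _ _
    _ = |(P.real S)⁻¹ * ∫ ω in S, f ω ∂P - ∫ ω, f ω ∂P| +
          |(P.real S')⁻¹ * ∫ ω in S', f ω ∂P - ∫ ω, f ω ∂P| := by rw [abs_sub_comm (∫ ω, f ω ∂P)]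
    _ ≤ 2 * C * P.real Sᶜ + 2 * C * P.real S'ᶜ := add_le_add h1 h2
    _ ≤ 2 * C * P.real Sᶜ + 2 * C * P.real Sᶜ := by
        have : 0 ≤ 2 * C := by linarith
        exact add_le_add le_rfl (mul_le_mul_of_nonneg_left hmono this)
    _ = 4 * C * P.real Sᶜ := by ring

/-! ## §3. The live threshold: print's small-field set versus the lowered one -/

/-- The small-field set of finitely many real variables at a threshold: `{ω | ∀ b ∈ B, |X_b ω| < s}`. [folklore] -/
theorem measurableSet_smallFieldSet {Ω : Type*} [MeasurableSpace Ω] {ι : Type*} (B : Finset ι) (X : ι → Ω → ℝ)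
    (hX : ∀ b ∈ B, Measurable (X b)) (s : ℝ) : MeasurableSet {ω | ∀ b ∈ B, |X b ω| < s} := by
  have : {ω | ∀ b ∈ B, |X b ω| < s} = ⋂ b ∈ B, {ω | |X b ω| < s} := by
    ext ω
    simp only [mem_setOf_eq, mem_iInter]
  rw [this]
  exact MeasurableSet.biInter B.countable_toSet fun b hb => measurableSet_lt (hX b hb).abs measurable_const

/-- **The lowered threshold's small-field set sits inside print's** (`λ ≦ 1`, `θ ≧ 0`): `{∀ b, |X_b| < λθ} ⊆ {∀ b, |X_b| < θ}`.
[folklore] -/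
theorem smallFieldSet_mono {Ω : Type*} {ι : Type*} (B : Finset ι) (X : ι → Ω → ℝ) {θ lam : ℝ} (hθ : 0 ≤ θ)
    (hlam : lam ≤ 1) : {ω | ∀ b ∈ B, |X b ω| < lam * θ} ⊆ {ω | ∀ b ∈ B, |X b ω| < θ} := by
  intro ω hω b hb
  have h := hω b hb
  have : lam * θ ≤ θ := by nlinarith
  exact lt_of_lt_of_le h this

/-- ENNReal-to-real conversion of the companion's tail form: `1 ≦ P(S) + ofReal r` with `r ≧ 0` gives `P(Sᶜ) ≦ r` in real
currency. [folklore] -/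
theorem measureReal_compl_le_of_one_le_add {Ω : Type*} [MeasurableSpace Ω] (P : Measure Ω) [IsProbabilityMeasure P]
    {S : Set Ω} (hS : MeasurableSet S) {r : ℝ} (hr : 0 ≤ r) (h : 1 ≤ P S + ENNReal.ofReal r) :
    P.real Sᶜ ≤ r := by
  have h1 : P Sᶜ ≤ ENNReal.ofReal r := by
    rw [prob_compl_eq_one_sub hS]
    exact tsub_le_iff_left.mpr h
  exact ENNReal.toReal_le_of_le_ofReal hr h1

/-- **HEADLINE — the C5′ mismatch under road (δ)'s live factor is exponentially small, uniformly in the factor.**  For a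
probability measure `P`, finitely many measurable real variables `X_b` (`b ∈ B`) with the (sub-)Gaussian single-variable
tails `P{λθ ≦ |X_b|} ≦ 2exp(−(λθ)²∕(2v))` at the LOWERED threshold, a bounded integrable observable `|f| ≦ C`, and the
clause `log(2#B) + target ≦ λ₀²θ²∕(2v)` asked ONCE at `λ₀` (the companion's `restrictedMass_lower_live`): for every
`λ ∈ [λ₀, 1]` the expectation of `f` restricted at `λθ` differs from the one restricted at print's `θ` by at most
`4C·exp(−target)`.  This SIZES census item C5′; its absorption as an 𝐑-class term is a design decision for the
(α)-instance, not proved here. [folklore] -/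
theorem restrictedMean_mismatch_live {Ω : Type*} [MeasurableSpace Ω] (P : Measure Ω) [IsProbabilityMeasure P]
    {ι : Type*} (B : Finset ι) (X : ι → Ω → ℝ) (hX : ∀ b ∈ B, Measurable (X b)) {f : Ω → ℝ} {C : ℝ} (hC : 0 ≤ C)
    (hf : ∀ ω, |f ω| ≤ C) (hfi : Integrable f P) {v θ lam lam₀ target : ℝ} (hv : 0 < v) (hθ : 0 ≤ θ)
    (h0 : 0 < lam₀) (hμ : lam₀ ≤ lam) (h1 : lam ≤ 1)
    (htail : ∀ b ∈ B, P {ω | lam * θ ≤ |X b ω|} ≤ ENNReal.ofReal (2 * Real.exp (-((lam * θ) ^ 2 / (2 * v)))))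
    (hclause : Real.log (2 * B.card) + target ≤ lam₀ ^ 2 * θ ^ 2 / (2 * v)) :
    |(P.real {ω | ∀ b ∈ B, |X b ω| < lam * θ})⁻¹ * ∫ ω in {ω | ∀ b ∈ B, |X b ω| < lam * θ}, f ω ∂P -
        (P.real {ω | ∀ b ∈ B, |X b ω| < θ})⁻¹ * ∫ ω in {ω | ∀ b ∈ B, |X b ω| < θ}, f ω ∂P| ≤
      4 * C * Real.exp (-target) := by
  have hS := measurableSet_smallFieldSet B X hX (lam * θ)
  have hS' := measurableSet_smallFieldSet B X hX θ
  have hsub := smallFieldSet_mono B X hθ h1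
  have hmass : P.real {ω | ∀ b ∈ B, |X b ω| < lam * θ}ᶜ ≤ Real.exp (-target) :=
    measureReal_compl_le_of_one_le_add P hS (Real.exp_pos _).le
      (restrictedMass_lower_live P B X hX hv h0 hμ htail hclause)
  have h := abs_restrictedMean_sub_restrictedMean_le P hC hf hfi hS hS' hsub
  have h4C : 0 ≤ 4 * C := by linarith
  exact h.trans (mul_le_mul_of_nonneg_left hmass h4C)

/-- **… and against the THRESHOLD-FREE convention** (C5′'s other repair, «define β threshold-free»): under the same inputs
the expectation restricted at the lowered threshold `λθ` differs from the UNRESTRICTED one by at most `2C·exp(−target)`,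
for every `λ ∈ [λ₀, 1]`. [folklore] -/
theorem restrictedMean_sub_mean_live {Ω : Type*} [MeasurableSpace Ω] (P : Measure Ω) [IsProbabilityMeasure P]
    {ι : Type*} (B : Finset ι) (X : ι → Ω → ℝ) (hX : ∀ b ∈ B, Measurable (X b)) {f : Ω → ℝ} {C : ℝ} (hC : 0 ≤ C)
    (hf : ∀ ω, |f ω| ≤ C) (hfi : Integrable f P) {v θ lam lam₀ target : ℝ} (hv : 0 < v) (h0 : 0 < lam₀)
    (hμ : lam₀ ≤ lam)
    (htail : ∀ b ∈ B, P {ω | lam * θ ≤ |X b ω|} ≤ ENNReal.ofReal (2 * Real.exp (-((lam * θ) ^ 2 / (2 * v)))))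
    (hclause : Real.log (2 * B.card) + target ≤ lam₀ ^ 2 * θ ^ 2 / (2 * v)) :
    |(P.real {ω | ∀ b ∈ B, |X b ω| < lam * θ})⁻¹ * ∫ ω in {ω | ∀ b ∈ B, |X b ω| < lam * θ}, f ω ∂P -
        ∫ ω, f ω ∂P| ≤ 2 * C * Real.exp (-target) := by
  have hS := measurableSet_smallFieldSet B X hX (lam * θ)
  have hmass : P.real {ω | ∀ b ∈ B, |X b ω| < lam * θ}ᶜ ≤ Real.exp (-target) :=
    measureReal_compl_le_of_one_le_add P hS (Real.exp_pos _).le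
      (restrictedMass_lower_live P B X hX hv h0 hμ htail hclause)
  have h := abs_restrictedMean_sub_mean_le P hC hf hfi hS
  have h2C : 0 ≤ 2 * C := by linarith
  exact h.trans (mul_le_mul_of_nonneg_left hmass h2C)

/-! ## §4. Sanity -/

/-- SANITY: with no variables (`B = ∅`) both small-field sets are everything, the two restricted means coincide, and
the headline's bound is the trivially true `0 ≦ 4C·exp(−target)` — the hypotheses are jointly satisfiable
(`target = 0`, `θ = v = λ = λ₀ = 1`: the clause reads `log 0 + 0 ≦ 1∕2`, true since `Real.log 0 = 0`). [folklore] -/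
example {Ω : Type*} [MeasurableSpace Ω] (P : Measure Ω) [IsProbabilityMeasure P] {f : Ω → ℝ} (hf : ∀ ω, |f ω| ≤ 1)
    (hfi : Integrable f P) :
    |(P.real {ω | ∀ b ∈ (∅ : Finset ℕ), |(fun _ _ => (0 : ℝ)) b ω| < 1 * 1})⁻¹ *
          ∫ ω in {ω | ∀ b ∈ (∅ : Finset ℕ), |(fun _ _ => (0 : ℝ)) b ω| < 1 * 1}, f ω ∂P -
        (P.real {ω | ∀ b ∈ (∅ : Finset ℕ), |(fun _ _ => (0 : ℝ)) b ω| < 1})⁻¹ *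
          ∫ ω in {ω | ∀ b ∈ (∅ : Finset ℕ), |(fun _ _ => (0 : ℝ)) b ω| < 1}, f ω ∂P| ≤
      4 * 1 * Real.exp (-0) :=
  restrictedMean_mismatch_live P ∅ (fun _ _ => 0) (by simp) zero_le_one hf hfi (v := 1) (θ := 1) (lam := 1)
    (lam₀ := 1) (target := 0) one_pos zero_le_one one_pos le_rfl le_rfl (by simp) (by simp)

end

end Summit.QuantumFields.BalabanUV.T4Continuum.Spine.NE7c.LiveFactorCouplingConvention
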